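import Mathlib
import HarnessLib

/-!
# SpectralPin, algebraic step: the level-2 corridor kernel has a non-vanishing 2×2 minor unless `b = 5/8`
(route `SAWTowerCount`, support item stmt-CriticalPhenomena-7259 `SpectralPin`; helper, `--supports`).

The route's level-2 kernel (decls `KacRankPin`, `PoissonKernelExpansion`) is
`K₂^b(y,y') = b(3(4cos²πy−1)(4cos²πy′−1)+1) + 32b(b−1)cos²πy cos²πy′`.
Evaluated at the two bulk rows `y ∈ {1/2, 1/3}` (`cos²` = `0`, `1/4`):
`K₂(½,½) = 4b`, `K₂(½,⅓) = K₂(⅓,½) = b`, `K₂(⅓,⅓) = 2b² − b`, so the minor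
`K₂(½,½)K₂(⅓,⅓) − K₂(½,⅓)K₂(⅓,½) = b²(8b−5)` — the `c = 0` level-2 Kac determinant read at two rows.
Hence a rank-one (factorising) level-2 kernel on the rows `{1/2,1/3}` forces `b = 5/8` (`b > 0`).
We also record the same conclusion for the kernel multiplied by the rank-one positive prefactor
`(2 sin πy sin πy′)^b` coming from `H_m(y,y')^b ∼ (2e^{−πm} sin πy sin πy′)^b`, which is the form in
which the exponential-fitting argument delivers it. No cited facts; elementary trigonometry.
-/

noncomputable section

namespace Summit.CriticalPhenomena.SAWScalingLimit.Theorems.SpectralPin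

/-- `cos (π * (1/2)) ^ 2 = 0`. -/
theorem cos_pi_mul_half_sq : Real.cos (Real.pi * (1 / 2)) ^ 2 = 0 := by
  rw [show Real.pi * (1 / 2) = Real.pi / 2 by ring, Real.cos_pi_div_two]
  norm_num

/-- `cos (π * (1/3)) ^ 2 = 1/4`. -/
theorem cos_pi_mul_third_sq : Real.cos (Real.pi * (1 / 3)) ^ 2 = 1 / 4 := by
  rw [show Real.pi * (1 / 3) = Real.pi / 3 by ring, Real.cos_pi_div_three]
  norm_num

/-- `sin (π * (1/2)) = 1`. -/
theorem sin_pi_mul_half : Real.sin (Real.pi * (1 / 2)) = 1 := by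
  rw [show Real.pi * (1 / 2) = Real.pi / 2 by ring, Real.sin_pi_div_two]

/-- `sin (π * (1/3)) = √3 / 2`. -/
theorem sin_pi_mul_third : Real.sin (Real.pi * (1 / 3)) = Real.sqrt 3 / 2 := by
  rw [show Real.pi * (1 / 3) = Real.pi / 3 by ring, Real.sin_pi_div_three]

/-- `0 < sin (π * (1/2))`. -/
theorem sin_pi_mul_half_pos : 0 < Real.sin (Real.pi * (1 / 2)) := by
  rw [sin_pi_mul_half]; exact one_pos

/-- `0 < sin (π * (1/3))`. -/
theorem sin_pi_mul_third_pos : 0 < Real.sin (Real.pi * (1 / 3)) := by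
  rw [sin_pi_mul_third]; positivity

/-- **Kac pin at two rows.** For `b > 0`, if the route's level-2 kernel
`K₂(y,y') = b(3(4cos²πy−1)(4cos²πy′−1)+1) + 32b(b−1)cos²πy cos²πy′` has vanishing 2×2 minor on the
rows `{1/2, 1/3}`, i.e. `K₂(½,½)·K₂(⅓,⅓) = K₂(½,⅓)·K₂(⅓,½)`, then `b = 5/8`
(the minor equals `b²(8b−5)`). -/
theorem b_eq_five_eighths_of_levelTwo_minor (b : ℝ) (hb : 0 < b) (K₂ : ℝ → ℝ → ℝ)
    (hK : ∀ y y' : ℝ, K₂ y y' = b * (3 * (4 * Real.cos (Real.pi * y) ^ 2 - 1) *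
      (4 * Real.cos (Real.pi * y') ^ 2 - 1) + 1) +
      32 * b * (b - 1) * Real.cos (Real.pi * y) ^ 2 * Real.cos (Real.pi * y') ^ 2)
    (hminor : K₂ (1 / 2) (1 / 2) * K₂ (1 / 3) (1 / 3) = K₂ (1 / 2) (1 / 3) * K₂ (1 / 3) (1 / 2)) :
    b = 5 / 8 := by
  have h11 : K₂ (1 / 2) (1 / 2) = 4 * b := by
    rw [hK, cos_pi_mul_half_sq]; ring
  have h12 : K₂ (1 / 2) (1 / 3) = b := by
    rw [hK, cos_pi_mul_half_sq, cos_pi_mul_third_sq]; ring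
  have h21 : K₂ (1 / 3) (1 / 2) = b := by
    rw [hK, cos_pi_mul_half_sq, cos_pi_mul_third_sq]; ring
  have h22 : K₂ (1 / 3) (1 / 3) = 2 * b ^ 2 - b := by
    rw [hK, cos_pi_mul_third_sq]; ring
  rw [h11, h12, h21, h22] at hminor
  -- `4b(2b² − b) = b·b`, i.e. `b²(8b − 5) = 0`
  have h : b ^ 2 * (8 * b - 5) = 0 := by nlinarith [hminor]
  rcases mul_eq_zero.mp h with h0 | h1
  · exact absurd ((pow_eq_zero_iff two_ne_zero).mp h0) hb.ne'
  · linarith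

/-- The prefactor `κ₀(y,y') = (2 sin πy sin πy′)^b` is a rank-one kernel: its 2×2 minors vanish
(stated for nonnegative sine values, as `Real.rpow` is multiplicative on nonnegative bases). -/
theorem prefactor_minor (b s₁ s₂ : ℝ) (h₁ : 0 ≤ s₁) (h₂ : 0 ≤ s₂) :
    (2 * s₁ * s₁) ^ b * (2 * s₂ * s₂) ^ b = (2 * s₁ * s₂) ^ b * (2 * s₂ * s₁) ^ b := by
  rw [← Real.mul_rpow (by positivity) (by positivity), ← Real.mul_rpow (by positivity) (by positivity)]
  ring_nf

/-- **Kac pin at two rows, weighted form.** If `V(y,y') = (2 sin πy sin πy′)^b · K₂(y,y')` (the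
level-2 coefficient kernel of `H_m(y,y')^b` in `e^{−πm}`, cf. `PoissonKernelExpansion`) has vanishing
2×2 minor on the rows `{1/2, 1/3}`, then `b = 5/8` (`b > 0`). -/
theorem b_eq_five_eighths_of_weighted_minor (b : ℝ) (hb : 0 < b) (K₂ V : ℝ → ℝ → ℝ)
    (hK : ∀ y y' : ℝ, K₂ y y' = b * (3 * (4 * Real.cos (Real.pi * y) ^ 2 - 1) *
      (4 * Real.cos (Real.pi * y') ^ 2 - 1) + 1) +
      32 * b * (b - 1) * Real.cos (Real.pi * y) ^ 2 * Real.cos (Real.pi * y') ^ 2)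
    (hV : ∀ y y' : ℝ, V y y' =
      (2 * Real.sin (Real.pi * y) * Real.sin (Real.pi * y')) ^ b * K₂ y y')
    (hminor : V (1 / 2) (1 / 2) * V (1 / 3) (1 / 3) = V (1 / 2) (1 / 3) * V (1 / 3) (1 / 2)) :
    b = 5 / 8 := by
  apply b_eq_five_eighths_of_levelTwo_minor b hb K₂ hK
  set s₁ := Real.sin (Real.pi * (1 / 2)) with hs₁
  set s₂ := Real.sin (Real.pi * (1 / 3)) with hs₂
  have hs₁pos : 0 < s₁ := sin_pi_mul_half_pos
  have hs₂pos : 0 < s₂ := sin_pi_mul_third_pos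
  have hP : (2 * s₁ * s₁) ^ b * (2 * s₂ * s₂) ^ b = (2 * s₁ * s₂) ^ b * (2 * s₂ * s₁) ^ b :=
    prefactor_minor b s₁ s₂ hs₁pos.le hs₂pos.le
  have hPpos : 0 < (2 * s₁ * s₂) ^ b * (2 * s₂ * s₁) ^ b :=
    mul_pos (Real.rpow_pos_of_pos (by positivity) _) (Real.rpow_pos_of_pos (by positivity) _)
  simp only [hV] at hminor
  -- rearrange: `(P₁₁P₂₂)·(K₁₁K₂₂) = (P₁₂P₂₁)·(K₁₂K₂₁)` with `P₁₁P₂₂ = P₁₂P₂₁ > 0`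
  have h' : ((2 * s₁ * s₂) ^ b * (2 * s₂ * s₁) ^ b) * (K₂ (1 / 2) (1 / 2) * K₂ (1 / 3) (1 / 3)) =
      ((2 * s₁ * s₂) ^ b * (2 * s₂ * s₁) ^ b) * (K₂ (1 / 2) (1 / 3) * K₂ (1 / 3) (1 / 2)) := by
    calc ((2 * s₁ * s₂) ^ b * (2 * s₂ * s₁) ^ b) * (K₂ (1 / 2) (1 / 2) * K₂ (1 / 3) (1 / 3))
        = ((2 * s₁ * s₁) ^ b * (2 * s₂ * s₂) ^ b) * (K₂ (1 / 2) (1 / 2) * K₂ (1 / 3) (1 / 3)) := by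
          rw [hP]
      _ = (2 * s₁ * s₁) ^ b * K₂ (1 / 2) (1 / 2) * ((2 * s₂ * s₂) ^ b * K₂ (1 / 3) (1 / 3)) := by ring
      _ = (2 * s₁ * s₂) ^ b * K₂ (1 / 2) (1 / 3) * ((2 * s₂ * s₁) ^ b * K₂ (1 / 3) (1 / 2)) := hminor
      _ = ((2 * s₁ * s₂) ^ b * (2 * s₂ * s₁) ^ b) * (K₂ (1 / 2) (1 / 3) * K₂ (1 / 3) (1 / 2)) := by ring
  exact mul_left_cancel₀ hPpos.ne' h'

end Summit.CriticalPhenomena.SAWScalingLimit.Theorems.SpectralPin
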